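import Mathlib
import HarnessLib
import Summits.HubbardSuperconductivity.HubbardSuperconductivity.Theorems.KLProgrammeKLRegimeEngineV8TowerExports2
import Summits.HubbardSuperconductivity.HubbardSuperconductivity.Theorems.KLProgrammeKLRegimeEngineLevelsExportBase

/-!
# Route `KLProgramme` — ENGINE child gen 8 (stmt-HubbardSuperconductivity-20437 `KLRegimeEngineV17F2`), SKELETON v2 class #1: the `n = 0` BASE of the
# MERGED export for the successor deferred table `klCU2` ((R55) §D (P0′) / (R55c) J3, J5; cell gate-hubbard-kl, seat p5 g8, co-owned with k3c2-p1)

`levelsUExportMixedAt_klCU2_zero`: under the v2 stub binders at scale `0` (`P.WF`, `R.WF2`, `0 < c ≤ klEngC₃6 P R`, `μ ∈ klWindowC`, `0 < U ≤ klEngU₀10 P R c`,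
`klBetaMin ≤ β ≤ e^{c/U²}`, `klEngL₄ P R β U ≤ L`, `klEngM₃ β U L ≤ M`, the bare flow frame admissible), for every RAISE `Q` of `klEngQ7 P R` with
`U ≤ klCUu2 P R (klEngQ7 P R) Q c` (the v2 composition feeds `Q := QT P R` and DefsU11's door row `klEngU₀11 ≤ klCUu2 … (QT P R) cc`):
`LevelsUExportMixedAt L M (klCU2 P R (klEngQ7 P R)) P β U μ 0`.

Proof = the sheet's `by_cases` device on the dite of `klExportPkg2`: THEN — the chosen package satisfies `LevelsUStep2`, applied at `n = 0` with
`G := klEngGeo8`, the raise `Q`, vacuous histories; ELSE — the package is the scale-0 package `(|(klEngQ7 P R).CE|^p, …)` (F* inside the successor),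
the merged export at `0` is the thin export (`levelsUExportMixedAt_zero_iff`: mixed rows are asked at levels `≥ 1` only), and k3c2-p1's
`levelsUExportAt_zero_klEng8` (conjunct 1 of the proved v2 stub (a)) applies with the domination `(klEngQ8 P R).CE^p ≤ klCU2 … p`.
Pure composition; no named facts; nothing asserts superconductivity.
-/

noncomputable section

namespace Summit.HubbardSuperconductivity.HubbardSuperconductivity.Theorems.EngineV8

set_option linter.dupNamespace false -- summit = problem name (single-conjunct summit), D-0017

open Real Finset Literature.MathematicalPhysics.QuantumLattice Literature.Probability.LatticeModels
open Literature.MathematicalPhysics.QuantumLattice.FermiRG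
open Summit.HubbardSuperconductivity.HubbardSuperconductivity.Theorems.KLRegimeSplit
open Summit.HubbardSuperconductivity.HubbardSuperconductivity.Theorems.KLProgrammeLegKernels
open Summit.HubbardSuperconductivity.HubbardSuperconductivity.Theorems.DispersionFlow

/-- **THE `n = 0` BASE OF CLASS #1 (successor table, merged export)**: see the module docstring. -/
theorem levelsUExportMixedAt_klCU2_zero (P : SplitConsts) (R : RenConsts) (c : ℝ) (hP : P.WF) (hR : R.WF2) (hc : 0 < c)
    (hc₆ : c ≤ klEngC₃6 P R) (μ : ℝ) (hμ : μ ∈ klWindowC) (U : ℝ) (hU : 0 < U) (hU₁₀ : U ≤ klEngU₀10 P R c)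
    (Q : EngConsts) (hQ : (klEngQ7 P R).IsRaiseOf Q) (hUu : U ≤ klCUu2 P R (klEngQ7 P R) Q c) (β : ℝ)
    (hβ : klBetaMin ≤ β) (hβc : β ≤ Real.exp (c / U ^ 2)) (L M : ℕ) [NeZero L] [NeZero M] (hL : klEngL₄ P R β U ≤ L)
    (hM : klEngM₃ β U L ≤ M) (hK : FrameOK R U (nScales β) μ (klFlowFrameU L M β U μ 0)) :
    LevelsUExportMixedAt L M (klCU2 P R (klEngQ7 P R)) P β U μ 0 := by
  classical
  by_cases h : ∃ e : (ℕ → ℝ) × ℝ × (EngConsts → ℝ → ℝ), IsExportPkg2 e ∧ LevelsUStep2 P R (klEngQ7 P R) e.1 e.2.2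
  · have hreg : IsKLRegime U c (-((0 : ℕ) : ℤ)) := by
      simp only [IsKLRegime, Nat.cast_zero, neg_zero, Int.cast_zero, abs_zero, mul_zero, zero_mul]
      exact hc.le
    exact levelsUStep2_klCU2_of_exists h klEngGeo8 klEngGeo8_wf Q hQ c hc hc₆ μ hμ U hU hU₁₀ hUu β hβ hβc L M hL hM 0 (Nat.zero_le _)
      hreg (fun j hj => absurd hj (Nat.not_lt_zero j)) hK (fun j hj => absurd hj (Nat.not_lt_zero j))
  · rw [levelsUExportMixedAt_zero_iff]
    exact levelsUExportAt_zero_klEng8 P R c hP hR hc hc₆ μ hμ U hU hU₁₀ β hβ hβc L M hL hM hK _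
      (fun p _ => by rw [klEngQ8_CE]; exact pow_CE_le_klCU2_of_not_exists h p)

/-- The same base fed at token table A (`Q := klEngQ8 P R`, `isRaiseOf_klEngQ8`). -/
theorem levelsUExportMixedAt_klCU2_zero_klEngQ8 (P : SplitConsts) (R : RenConsts) (c : ℝ) (hP : P.WF) (hR : R.WF2) (hc : 0 < c)
    (hc₆ : c ≤ klEngC₃6 P R) (μ : ℝ) (hμ : μ ∈ klWindowC) (U : ℝ) (hU : 0 < U) (hU₁₀ : U ≤ klEngU₀10 P R c)
    (hUu : U ≤ klCUu2 P R (klEngQ7 P R) (klEngQ8 P R) c) (β : ℝ)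
    (hβ : klBetaMin ≤ β) (hβc : β ≤ Real.exp (c / U ^ 2)) (L M : ℕ) [NeZero L] [NeZero M] (hL : klEngL₄ P R β U ≤ L)
    (hM : klEngM₃ β U L ≤ M) (hK : FrameOK R U (nScales β) μ (klFlowFrameU L M β U μ 0)) :
    LevelsUExportMixedAt L M (klCU2 P R (klEngQ7 P R)) P β U μ 0 :=
  levelsUExportMixedAt_klCU2_zero P R c hP hR hc hc₆ μ hμ U hU hU₁₀ (klEngQ8 P R) (isRaiseOf_klEngQ8 P R) hUu β hβ hβc L M hL hM hK

end Summit.HubbardSuperconductivity.HubbardSuperconductivity.Theorems.EngineV8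

end
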